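import Summits.QuantumFields.BalabanUV.Beta.GAN24.DerivativeRateTransferJensenMeanZeroPolar

/-!
# `BalabanUV.Beta.GAN24.DerivativeRateTransferJensenMassFree` — binder row G-an2-4 ∕ (CONV-C), route R6 «VALUES, NOT DERIVATIVES», PART 52:
# THE MASS-FREE COVARIANT JENSEN INEQUALITY, I — THE POLAR MASS LEMMA AND THE ABSTRACT MASS-DATUM END: the block «mass» term of PART 47's
# three-term split is a `q`-VARIANCE (bounded by the second moment about ANY centre) whenever the mean root-frame defect is symmetric, and PART 47's
# END holds with the `κ₂`-letter replaced by any per-bond mass datum with a budget `Z` (unit b2b-balaban-gan24-p3, gen 43; v1; the mechanism «the coarse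
# mass is loop energy» is gan24-idea-1 g56's LENS ITEM 13 ∕ located supply L-idea1-g56-1 — credited, typed here)

NOT IN PRINT; OUR PROOF (for the ROUTE; [folklore] finite-dimensional linear algebra over `ℝ`: the centring identity of a weighted mean, Cauchy–Schwarz
for a symmetric positive-semidefinite matrix form (PART 51 `form_cauchySchwarz`), PART 21's chain bound, PART 22's counting sums and PART 47's
three-term split BY NAME).  HONEST FRAMING (cell contract, verbatim): «discharging `BetaPertH` makes Bałaban's UV stability UNCONDITIONAL — a real
constructive-QFT result; it is NOT the continuum limit and NOT the Clay problem.»  HONEST DEPENDENCY (verbatim): «continuum YM on T⁴ ⇐ BetaPertH ∧ nine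
spine estimates (0/9 proved); BetaPertH ⇐ (D1) ∧ (D4) ∧ CAP+tail; G-an2-4 gates asym, D1 and NE2/3/4.»

WHY THIS FILE.  PART 47 (`DerivativeRateTransferJensenMeanZero.coarseDiff_avg_eq_three`) splits the coarse covariant difference of a transported
block mean per coarse bond `e′ = (y → y′)` EXACTLY as `A + F + S·c̄` — the block mean of transported fine CHAINS, the pointwise root-frame defects on the
FLUCTUATION, and the block-MEAN defect `S := Σ_x q(y,x)·N_x` on `c̄ := R′(Qu)(y′)`; PARTs 47 ∕ 48 ∕ 50 ∕ 51 then pay the third term as an ADDITIVE Gram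
slack `|S c̄|² ≤ κ₂²|c̄|²`, i.e. `δ·⟨Qu,Qu⟩` with `δ ∝ κ₂²` (`κ₂ = κ²∕2` for the polar pair, PART 51) — in class-T units `δ_j ≍ p̂_j³`, which the
pricing desk books as «short of the rate `η^{2d}` in `d = 4`; NEEDS-ROW (D)(ii)» (PRICING-GAN24 v3.49 ∕ v3.50; gan24-idea-1 g57's REMARK 1 on PART 51).
THIS FILE and PART 53 (`DerivativeRateTransferJensenMassFreeEnd`) remove the additive term for the POLAR pair.  (§1) THE POLAR MASS LEMMA
`meanDefect_sq_le_wmoment`: for a `q`-mean (`q ≥ 0`, `Σq = 1`) of orthogonal `V_x` with pointwise defects `|(1 − V_x)w|² ≤ κ²|w|²` whose mean defect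
`S = Σ_x q_x(1 − V_x)` is SYMMETRIC (the polar ∕ «Wilson average» convention (1.26) of Bałaban–Jaffe, Erice 1985 — PART 51 `wsum_defect_symm_of_polar`),
and ANY centre `a`,
  `(4 − κ²)·|S c|² ≤ κ²·Σ_x q_x|V_x c − a|²`
(Cauchy–Schwarz in the `S`-form gives `|Sc|² ≤ (κ²∕2)⟨c,Sc⟩ = (κ²∕4)Σ_x q_x|(1 − V_x)c|²`; the centring identity gives `Σ_x q_x|(1 − V_x)c|² = |Sc|² +
Var_q(V_xc) ≤ |Sc|² + Σ_x q_x|V_xc − a|²` — the MASS IS A VARIANCE, and a variance is a second moment about any centre; this is (B1)–(B2) of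
L-idea1-g56-1 with the pair-difference sum replaced by the second moment, constant `1` instead of `2`).  (§2) THE ABSTRACT MASS-DATUM END
`covJensen_massDatum`: PART 47's `covJensen_meanZero` with the `κ₂`-hypothesis `hM` REPLACED by a per-bond mass datum `|S_{e′}c̄_{e′}|² ≤ Ψ(e′)` and a
budget `w_c·Σ_{e′}Ψ(e′) ≤ Z`:  `⟨Qu,H_cQu⟩ ≤ (1 + t + (1+t⁻¹)(1+r)ϖκ²)⟨u,H_fu⟩ + (1+t⁻¹)(1+r⁻¹)·Z` for all `t, r > 0` (any convention; PART 47 is the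
case `Z = κ₂²w_c d′⟨Qu,Qu⟩`).  PART 53 takes the centre `a := (Qu)(y)`, telescopes `V_xc̄ − (Qu)(y)` through the field values `u(σx)`, `u(x)` into a
Poincaré fluctuation at `y′`, a transported CHAIN of fine differences and a Poincaré fluctuation at `y`, and gets `Z = 3κ²(1 + ϖ + ϖ′)∕(4 − κ²)·⟨u,H_fu⟩`:
(STAB-ε,δ) with `δ = 0` for the polar pair.

WHAT THIS FILE PROVES (0 sorry, 0 `def`, nothing cited): §1 `wsum_sq_le_sq_mean_add_wmoment`, `sq_mulVec_le_mul_form`, `form_wsum_defect_eq`,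
**`meanDefect_sq_le_wmoment`**; §2 **`sum_coarseDiff_sq_le_massDatum`** (the bound on the weighted coarse bond energy `w_cΣ_{e′}|D′_{e′}(Qu)|²` itself),
**`covJensen_massDatum`**.
WHAT IT DOES NOT DO: produce the polar mass datum or the `δ = 0` END (PART 53), instantiate the letters on PART 24's block lattice or discharge
`Φ ∕ ϖ` from tree transports, prove that the polar factor EXISTS for `SU(N)` or treat (1.27) ∕ (1.28), bound `κ` by the plaquette letter, instantiate
anything of Bałaban's (`G_k`, `H_k`, `C^{(k)}`), or claim (CONS) ∕ exact (STAB).  SUPPLIER work on route R6 (rank 2, REDUCTION, no seat); no consumer of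
record; NEVER «G-an2-4 closed»; NOT (CONV-C), NOT D1, NOT `BetaPertH`, NOT continuum, NOT Clay.  Records: `HOME/b2b-balaban-gan24-p3/WOODBURY-FIBRE.md`
v14.3, `HOME/beta/ROUTES-GAN24.md` v56 (R6 — v56 NOTE, LENS ITEM 13), `HOME/b2b-balaban-gan24-refuter/PRICING-GAN24.md` v3.50 (Q-56-1 ∕ Q-56-3). -/

noncomputable section

open Matrix Finset

namespace Summit.QuantumFields.BalabanUV.Beta.GAN24.DerivativeRateTransferJensenMassFree

open Summit.QuantumFields.BalabanUV.Beta.GAN24.DerivativeRateTransferLoewnerKKT (mulVec_dotProduct_eq)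
open Summit.QuantumFields.BalabanUV.Beta.GAN24.DerivativeRateTransferJensenChain
open Summit.QuantumFields.BalabanUV.Beta.GAN24.DerivativeRateTransferJensen
open Summit.QuantumFields.BalabanUV.Beta.GAN24.DerivativeRateTransferJensenMeanZero
open Summit.QuantumFields.BalabanUV.Beta.GAN24.DerivativeRateTransferJensenMeanZeroPolar

/-! ## §1 Tools and the polar mass lemma -/

section Tools

variable {o : Type*} [Fintype o]

/-- **SECOND MOMENT ABOUT ANY CENTRE DOMINATES THE VARIANCE**: weights with `Σ_x q_x = 1`, vectors `w_x`, mean `m = Σ_x q_x•w_x`, any `b`: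
`Σ_x q_x|w_x|² ≤ |m|² + Σ_x q_x|w_x − b|²` (indeed `Σq|w − b|² − (Σq|w|² − |m|²) = |m − b|²`). [folklore] -/
theorem wsum_sq_le_sq_mean_add_wmoment {ν : Type*} (s : Finset ν) {q : ν → ℝ} (hq1 : ∑ x ∈ s, q x = 1) (w : ν → o → ℝ) (b : o → ℝ) :
    ∑ x ∈ s, q x * (w x ⬝ᵥ w x) ≤
      (∑ x ∈ s, q x • w x) ⬝ᵥ (∑ x ∈ s, q x • w x) + ∑ x ∈ s, q x * ((w x - b) ⬝ᵥ (w x - b)) := by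
  set m : o → ℝ := ∑ x ∈ s, q x • w x with hm
  have hlin : ∑ x ∈ s, q x * (w x ⬝ᵥ b) = m ⬝ᵥ b := by
    rw [hm, sum_dotProduct]
    exact Finset.sum_congr rfl fun x _ => by rw [smul_dotProduct, smul_eq_mul]
  have hexp : ∑ x ∈ s, q x * ((w x - b) ⬝ᵥ (w x - b)) = ∑ x ∈ s, q x * (w x ⬝ᵥ w x) - 2 * (m ⬝ᵥ b) + b ⬝ᵥ b := by
    have h : ∀ x ∈ s, q x * ((w x - b) ⬝ᵥ (w x - b)) = q x * (w x ⬝ᵥ w x) - 2 * (q x * (w x ⬝ᵥ b)) + q x * (b ⬝ᵥ b) := by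
      intro x _
      rw [sub_dotProduct, dotProduct_sub, dotProduct_sub, dotProduct_comm b (w x)]; ring
    rw [Finset.sum_congr rfl h, Finset.sum_add_distrib, Finset.sum_sub_distrib, ← Finset.mul_sum, hlin, ← Finset.sum_mul, hq1, one_mul]
  have h0 : 0 ≤ (m - b) ⬝ᵥ (m - b) := dotProduct_self_nonneg' _
  rw [sub_dotProduct, dotProduct_sub, dotProduct_sub, dotProduct_comm b m] at h0
  rw [hexp]
  linarith

/-- **`|Sc|² ≤ s·⟨c,Sc⟩`** for a symmetric matrix with `0 ≤ ⟨w,Sw⟩ ≤ s|w|²` (`0 ≤ s`): Cauchy–Schwarz in the `S`-form (PART 51 `form_cauchySchwarz`),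
`|Sc|⁴ = ⟨c,S(Sc)⟩² ≤ ⟨c,Sc⟩·⟨Sc,S(Sc)⟩ ≤ ⟨c,Sc⟩·s|Sc|²`. [folklore] -/
theorem sq_mulVec_le_mul_form {S : Matrix o o ℝ} (hS : Sᵀ = S) {s : ℝ} (hs : 0 ≤ s) (hpsd : ∀ w : o → ℝ, 0 ≤ w ⬝ᵥ (S *ᵥ w))
    (hle : ∀ w : o → ℝ, w ⬝ᵥ (S *ᵥ w) ≤ s * (w ⬝ᵥ w)) (c : o → ℝ) :
    (S *ᵥ c) ⬝ᵥ (S *ᵥ c) ≤ s * (c ⬝ᵥ (S *ᵥ c)) := by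
  have hcs := form_cauchySchwarz hS hpsd c (S *ᵥ c)
  have e : c ⬝ᵥ (S *ᵥ (S *ᵥ c)) = (S *ᵥ c) ⬝ᵥ (S *ᵥ c) := by rw [dotProduct_mulVec_symm hS c (S *ᵥ c)]
  rw [e] at hcs
  have h2 : ((S *ᵥ c) ⬝ᵥ (S *ᵥ c)) * ((S *ᵥ c) ⬝ᵥ (S *ᵥ c)) ≤ (s * (c ⬝ᵥ (S *ᵥ c))) * ((S *ᵥ c) ⬝ᵥ (S *ᵥ c)) := by
    calc ((S *ᵥ c) ⬝ᵥ (S *ᵥ c)) * ((S *ᵥ c) ⬝ᵥ (S *ᵥ c)) = ((S *ᵥ c) ⬝ᵥ (S *ᵥ c)) ^ 2 := (sq _).symm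
      _ ≤ (c ⬝ᵥ (S *ᵥ c)) * ((S *ᵥ c) ⬝ᵥ (S *ᵥ (S *ᵥ c))) := hcs
      _ ≤ (c ⬝ᵥ (S *ᵥ c)) * (s * ((S *ᵥ c) ⬝ᵥ (S *ᵥ c))) := mul_le_mul_of_nonneg_left (hle _) (hpsd c)
      _ = (s * (c ⬝ᵥ (S *ᵥ c))) * ((S *ᵥ c) ⬝ᵥ (S *ᵥ c)) := by ring
  have hX0 : 0 ≤ (S *ᵥ c) ⬝ᵥ (S *ᵥ c) := dotProduct_self_nonneg' _
  rcases eq_or_lt_of_le hX0 with hX | hX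
  · rw [← hX]; exact mul_nonneg hs (hpsd c)
  · exact le_of_mul_le_mul_right h2 hX

variable [DecidableEq o]

/-- `⟨c,(Σ_x q_x(1 − V_x))c⟩ = ½·Σ_x q_x|(1 − V_x)c|²` for orthogonal `V_x` (PART 51 `form_one_sub_eq_half` summed) — the form of the mean defect is
half the `q`-energy of the pointwise defects; no symmetry needed. [folklore] -/
theorem form_wsum_defect_eq {ν : Type*} (s : Finset ν) (q : ν → ℝ) {V : ν → Matrix o o ℝ} (hV : ∀ x ∈ s, (V x)ᵀ * V x = 1) (c : o → ℝ) :
    c ⬝ᵥ ((∑ x ∈ s, q x • (1 - V x)) *ᵥ c) = (1 / 2 : ℝ) * ∑ x ∈ s, q x * (((1 - V x) *ᵥ c) ⬝ᵥ ((1 - V x) *ᵥ c)) := by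
  rw [Matrix.sum_mulVec, dotProduct_sum, Finset.mul_sum]
  refine Finset.sum_congr rfl fun x hx => ?_
  rw [smul_mulVec, dotProduct_smul, smul_eq_mul, form_one_sub_eq_half (hV x hx)]
  ring

/-- **`meanDefect_sq_le_wmoment` — THE POLAR MASS LEMMA** [our proof; mechanism = (B1)–(B2) of gan24-idea-1 g56's L-idea1-g56-1, sharpened]: weights
`q ≥ 0` with `Σ_x q_x = 1`, orthogonal `V_x` with pointwise defects `|(1 − V_x)w|² ≤ κ²|w|²`, and the mean defect `S = Σ_x q_x(1 − V_x)` SYMMETRIC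
(the polar convention) ⟹ for every `c` and EVERY centre `a`:  `(4 − κ²)·|S c|² ≤ κ²·Σ_x q_x|V_x c − a|²`.
(`|Sc|² ≤ (κ²∕2)⟨c,Sc⟩ = (κ²∕4)Σq|(1 − V_x)c|²` and `Σq|(1 − V_x)c|² ≤ |Sc|² + Σq|V_xc − a|²`: the mass is the `q`-VARIANCE of the family
`{V_xc}`, bounded by its second moment about any centre.) -/
theorem meanDefect_sq_le_wmoment {ν : Type*} (s : Finset ν) {q : ν → ℝ} (hq : ∀ x ∈ s, 0 ≤ q x) (hq1 : ∑ x ∈ s, q x = 1)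
    {V : ν → Matrix o o ℝ} (hV : ∀ x ∈ s, (V x)ᵀ * V x = 1) {κ : ℝ}
    (hκ : ∀ x ∈ s, ∀ w : o → ℝ, (((1 - V x) *ᵥ w) ⬝ᵥ ((1 - V x) *ᵥ w)) ≤ κ ^ 2 * (w ⬝ᵥ w))
    (hsym : (∑ x ∈ s, q x • (1 - V x))ᵀ = ∑ x ∈ s, q x • (1 - V x)) (c a : o → ℝ) :
    (4 - κ ^ 2) * (((∑ x ∈ s, q x • (1 - V x)) *ᵥ c) ⬝ᵥ ((∑ x ∈ s, q x • (1 - V x)) *ᵥ c)) ≤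
      κ ^ 2 * ∑ x ∈ s, q x * ((V x *ᵥ c - a) ⬝ᵥ (V x *ᵥ c - a)) := by
  set S : Matrix o o ℝ := ∑ x ∈ s, q x • (1 - V x) with hSdef
  -- (B1) Cauchy–Schwarz in the `S`-form: `|Sc|² ≤ (κ²∕2)·⟨c,Sc⟩ = (κ²∕4)·Σ q|(1 − V_x)c|²`
  have hb := fun w => wsum_defect_form_bounds s hq hq1.le hV hκ w
  have h1 : (S *ᵥ c) ⬝ᵥ (S *ᵥ c) ≤ κ ^ 2 / 2 * (c ⬝ᵥ (S *ᵥ c)) :=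
    sq_mulVec_le_mul_form hsym (by positivity) (fun w => (hb w).1) (fun w => (hb w).2) c
  rw [hSdef, form_wsum_defect_eq s q hV c] at h1
  have h1' : 4 * ((S *ᵥ c) ⬝ᵥ (S *ᵥ c)) ≤ κ ^ 2 * ∑ x ∈ s, q x * (((1 - V x) *ᵥ c) ⬝ᵥ ((1 - V x) *ᵥ c)) := by
    have e : κ ^ 2 / 2 * ((1 / 2 : ℝ) * ∑ x ∈ s, q x * (((1 - V x) *ᵥ c) ⬝ᵥ ((1 - V x) *ᵥ c))) =
        (κ ^ 2 * ∑ x ∈ s, q x * (((1 - V x) *ᵥ c) ⬝ᵥ ((1 - V x) *ᵥ c))) / 4 := by ring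
    rw [e] at h1
    linarith
  -- (B2) the centring identity: `Σ q|(1 − V_x)c|² ≤ |Sc|² + Σ q|V_xc − a|²` (second moment about the centre `c − a`)
  have h2 := wsum_sq_le_sq_mean_add_wmoment s hq1 (fun x => (1 - V x) *ᵥ c) (c - a)
  have em : ∑ x ∈ s, q x • ((1 - V x) *ᵥ c) = S *ᵥ c := by
    rw [hSdef, Matrix.sum_mulVec]; exact Finset.sum_congr rfl fun x _ => (smul_mulVec _ _ _).symm
  have ed : ∀ x, ((1 - V x) *ᵥ c - (c - a)) ⬝ᵥ ((1 - V x) *ᵥ c - (c - a)) = (V x *ᵥ c - a) ⬝ᵥ (V x *ᵥ c - a) := by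
    intro x
    have : (1 - V x) *ᵥ c - (c - a) = -(V x *ᵥ c - a) := by rw [sub_mulVec, one_mulVec]; abel
    rw [this, neg_dotProduct, dotProduct_neg, neg_neg]
  simp only [em, ed] at h2
  -- combine: `4|Sc|² ≤ κ²(|Sc|² + Σq|V_xc − a|²)`
  have hκ2 : 0 ≤ κ ^ 2 := sq_nonneg κ
  have h3 : κ ^ 2 * ∑ x ∈ s, q x * (((1 - V x) *ᵥ c) ⬝ᵥ ((1 - V x) *ᵥ c)) ≤
      κ ^ 2 * ((S *ᵥ c) ⬝ᵥ (S *ᵥ c)) + κ ^ 2 * ∑ x ∈ s, q x * ((V x *ᵥ c - a) ⬝ᵥ (V x *ᵥ c - a)) := by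
    rw [← mul_add]; exact mul_le_mul_of_nonneg_left h2 hκ2
  calc (4 - κ ^ 2) * ((S *ᵥ c) ⬝ᵥ (S *ᵥ c)) = 4 * ((S *ᵥ c) ⬝ᵥ (S *ᵥ c)) - κ ^ 2 * ((S *ᵥ c) ⬝ᵥ (S *ᵥ c)) := by ring
    _ ≤ κ ^ 2 * ∑ x ∈ s, q x * ((V x *ᵥ c - a) ⬝ᵥ (V x *ᵥ c - a)) := by linarith

end Tools

/-! ## §2 The abstract mass-datum END -/

section MassDatum

variable {o μ ν β β' : Type*} [Fintype o] [DecidableEq o] [Fintype μ] [Fintype ν] [Fintype β] [DecidableEq β] [Fintype β']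
variable {q : μ → ν → ℝ} {W : μ → ν → Matrix o o ℝ} {Q : Matrix (μ × o) (ν × o) ℝ}
variable {src tgt : β → ν} {R : β → Matrix o o ℝ} {src' tgt' : β' → μ} {R' : β' → Matrix o o ℝ}
variable {Hf : Matrix (ν × o) (ν × o) ℝ} {Hc : Matrix (μ × o) (μ × o) ℝ} {wf wc : ℝ}
variable {σ : β' → ν ≃ ν} {ℓ : ℕ} {xs : β' → ν → ℕ → ν} {γ : β' → ν → ℕ → β} {T : β' → ν → ℕ → Matrix o o ℝ} {m : ℝ}
variable {N : β' → ν → Matrix o o ℝ} {Φ : (ν × o → ℝ) → μ → ℝ} {Ψ : β' → ℝ} {ϖ κ Z : ℝ}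

omit [Fintype μ] in
/-- **`sum_coarseDiff_sq_le_massDatum` — THE ABSTRACT MASS-DATUM BOUND ON THE COARSE BOND ENERGY** [our proof]: PART 47's setting with the
block-mean-defect letter `κ₂` REPLACED by a per-bond MASS DATUM — for the given field `u`, `|S_{e′}·R′_{e′}(Qu)(tgt′e′)|² ≤ Ψ(e′)`
(`S_{e′} = Σ_x q(src′e′,x)·N(e′,x)`) with budget `w_c·Σ_{e′}Ψ(e′) ≤ Z` — everything else as in PART 47 (block weights `q ≥ 0`, `Σ_x q(y,x) ≤ 1`,
orthogonal `W, R, R′`, averaging identity `hQ`, fine form bound `hHf`, pairings `σ`, straight chains `xs ∕ γ ∕ T` of length `ℓ` with q-weighted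
multiplicity `≤ m`, `w_c·ℓ·m ≤ w_f`, root-frame defects `N` with `|Nw|² ≤ κ²|w|²`, Poincaré datum `hP ∕ hΦ`).  THEN for all `t, r > 0` the weighted
coarse bond energy of the block mean obeys `w_c·Σ_{e′}|R′_{e′}(Qu)(tgt′e′) − (Qu)(src′e′)|² ≤ (1 + t + (1+t⁻¹)(1+r)ϖκ²)·⟨u, H_f u⟩ + (1+t⁻¹)(1+r⁻¹)·Z`
(stated on the bond sum, so that a SECOND coarse connection can be compared with `R′` bond by bond — the convention-transfer END of a later PART). -/
theorem sum_coarseDiff_sq_le_massDatum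
    (hq : ∀ y x, 0 ≤ q y x) (hq1 : ∀ y, ∑ x, q y x ≤ 1) (hW : ∀ y x, (W y x)ᵀ * W y x = 1) (hR : ∀ e, (R e)ᵀ * R e = 1)
    (hR' : ∀ e', (R' e')ᵀ * R' e' = 1)
    (hQ : ∀ (u : ν × o → ℝ) (y : μ), (fun a => (Q *ᵥ u) (y, a)) = ∑ x, q y x • (W y x *ᵥ fun b => u (x, b)))
    (hwc : 0 ≤ wc)
    (hHf : ∀ u : ν × o → ℝ, wf * ∑ e, ((R e *ᵥ fun b => u (tgt e, b)) - fun b => u (src e, b)) ⬝ᵥ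
        ((R e *ᵥ fun b => u (tgt e, b)) - fun b => u (src e, b)) ≤ u ⬝ᵥ (Hf *ᵥ u))
    (hσq : ∀ e' x, q (tgt' e') (σ e' x) = q (src' e') x)
    (hx0 : ∀ e' x, xs e' x 0 = x) (hxℓ : ∀ e' x, xs e' x ℓ = σ e' x)
    (hsrc : ∀ e' x i, i < ℓ → src (γ e' x i) = xs e' x i) (htgt : ∀ e' x i, i < ℓ → tgt (γ e' x i) = xs e' x (i + 1))
    (hT0 : ∀ e' x, T e' x 0 = 1) (hT : ∀ e' x i, i < ℓ → T e' x (i + 1) = T e' x i * R (γ e' x i))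
    (hmult : ∀ e, ∑ e', ∑ x, ∑ i ∈ range ℓ, (if γ e' x i = e then q (src' e') x else 0) ≤ m)
    (hw : wc * ℓ * m ≤ wf)
    (hNdef : ∀ e' x, N e' x = 1 - W (src' e') x * T e' x ℓ * (W (tgt' e') (σ e' x))ᵀ * (R' e')ᵀ)
    (hN : ∀ e' x (w : o → ℝ), (N e' x *ᵥ w) ⬝ᵥ (N e' x *ᵥ w) ≤ κ ^ 2 * (w ⬝ᵥ w))
    (u : ν × o → ℝ)
    (hP : ∀ y, ∑ x, q y x * (((W y x *ᵥ fun b => u (x, b)) - fun a => (Q *ᵥ u) (y, a)) ⬝ᵥ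
        ((W y x *ᵥ fun b => u (x, b)) - fun a => (Q *ᵥ u) (y, a))) ≤ Φ u y)
    (hΦ : wc * ∑ e', Φ u (tgt' e') ≤ ϖ * (u ⬝ᵥ (Hf *ᵥ u)))
    (hS : ∀ e', ((∑ x, q (src' e') x • N e' x) *ᵥ (R' e' *ᵥ fun a => (Q *ᵥ u) (tgt' e', a))) ⬝ᵥ
        ((∑ x, q (src' e') x • N e' x) *ᵥ (R' e' *ᵥ fun a => (Q *ᵥ u) (tgt' e', a))) ≤ Ψ e')
    (hΨ : wc * ∑ e', Ψ e' ≤ Z)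
    {t r : ℝ} (ht : 0 < t) (hr : 0 < r) :
    wc * ∑ e', ((R' e' *ᵥ fun a => (Q *ᵥ u) (tgt' e', a)) - fun a => (Q *ᵥ u) (src' e', a)) ⬝ᵥ
        ((R' e' *ᵥ fun a => (Q *ᵥ u) (tgt' e', a)) - fun a => (Q *ᵥ u) (src' e', a)) ≤
      (1 + t + (1 + t⁻¹) * (1 + r) * ϖ * κ ^ 2) * (u ⬝ᵥ (Hf *ᵥ u)) + (1 + t⁻¹) * (1 + r⁻¹) * Z := by
  set F : β → ℝ := fun e => ((R e *ᵥ fun b => u (tgt e, b)) - fun b => u (src e, b)) ⬝ᵥ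
    ((R e *ᵥ fun b => u (tgt e, b)) - fun b => u (src e, b)) with hF
  have hF0 : ∀ e, 0 ≤ F e := fun e => dotProduct_self_nonneg' _
  have ht' : (0 : ℝ) ≤ 1 + t⁻¹ := by positivity
  have hr' : (0 : ℝ) ≤ 1 + r⁻¹ := by positivity
  have hr1 : (0 : ℝ) ≤ 1 + r := by positivity
  -- per coarse bond: the three-term split; (A) and (B) as in PART 47, (C) by the mass datum
  have hper : ∀ e',
      ((R' e' *ᵥ fun a => (Q *ᵥ u) (tgt' e', a)) - fun a => (Q *ᵥ u) (src' e', a)) ⬝ᵥ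
          ((R' e' *ᵥ fun a => (Q *ᵥ u) (tgt' e', a)) - fun a => (Q *ᵥ u) (src' e', a)) ≤
        (1 + t) * (ℓ * ∑ x, q (src' e') x * ∑ i ∈ range ℓ, F (γ e' x i)) +
          (1 + t⁻¹) * ((1 + r) * (κ ^ 2 * Φ u (tgt' e')) + (1 + r⁻¹) * Ψ e') := by
    intro e'
    have hSe := hS e'
    set c : o → ℝ := R' e' *ᵥ fun a => (Q *ᵥ u) (tgt' e', a) with hc
    rw [coarseDiff_avg_eq_three hQ (hR' e') (fun x => hW (tgt' e') x) (σ e') (hσq e') (fun x => T e' x ℓ) (fun x => hNdef e' x) c u]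
    refine (dotProduct_self_add_add_le _ _ _ ht hr).trans ?_
    refine add_le_add ?_ (mul_le_mul_of_nonneg_left (add_le_add ?_ (mul_le_mul_of_nonneg_left hSe hr')) ht')
    · -- (A) the chain term
      refine mul_le_mul_of_nonneg_left ?_ (by linarith)
      refine (dotProduct_self_wsum_le Finset.univ (fun x _ => hq _ x) (hq1 _) (fun x _ => hW (src' e') x) _).trans ?_
      rw [Finset.mul_sum]
      refine Finset.sum_le_sum fun x _ => ?_
      have h := dotProduct_self_chain_le (R := fun i => R (γ e' x i)) (T := T e' x) (fun i _ => hR _) (hT0 e' x)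
        (fun i hi => hT e' x i hi) (fun i => fun b => u (xs e' x i, b))
      rw [hxℓ, hx0] at h
      have hs : ∑ i ∈ range ℓ, F (γ e' x i) =
          ∑ i ∈ range ℓ, ((R (γ e' x i) *ᵥ fun b => u (xs e' x (i + 1), b)) - fun b => u (xs e' x i, b)) ⬝ᵥ
            ((R (γ e' x i) *ᵥ fun b => u (xs e' x (i + 1), b)) - fun b => u (xs e' x i, b)) :=
        Finset.sum_congr rfl fun i hi => by simp only [hF]; rw [hsrc e' x i (mem_range.mp hi), htgt e' x i (mem_range.mp hi)]
      rw [hs]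
      calc q (src' e') x * ((T e' x ℓ *ᵥ (fun b => u (σ e' x, b)) - fun b => u (x, b)) ⬝ᵥ
              (T e' x ℓ *ᵥ (fun b => u (σ e' x, b)) - fun b => u (x, b)))
          ≤ q (src' e') x * (ℓ * ∑ i ∈ range ℓ, ((R (γ e' x i) *ᵥ fun b => u (xs e' x (i + 1), b)) - fun b => u (xs e' x i, b)) ⬝ᵥ
              ((R (γ e' x i) *ᵥ fun b => u (xs e' x (i + 1), b)) - fun b => u (xs e' x i, b))) :=
            mul_le_mul_of_nonneg_left h (hq _ x)
        _ = ℓ * (q (src' e') x * ∑ i ∈ range ℓ, ((R (γ e' x i) *ᵥ fun b => u (xs e' x (i + 1), b)) - fun b => u (xs e' x i, b)) ⬝ᵥ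
              ((R (γ e' x i) *ᵥ fun b => u (xs e' x (i + 1), b)) - fun b => u (xs e' x i, b))) := by ring
    · -- (B) pointwise defects against the fluctuation
      refine mul_le_mul_of_nonneg_left ?_ hr1
      refine (dotProduct_self_wsum_defect_le Finset.univ (fun x _ => hq _ x) (hq1 _) (fun x _ w => hN e' x w) _).trans ?_
      refine mul_le_mul_of_nonneg_left ?_ (sq_nonneg κ)
      have hre : ∀ x, ((R' e' *ᵥ (W (tgt' e') (σ e' x) *ᵥ fun b => u (σ e' x, b))) - c) ⬝ᵥ
            ((R' e' *ᵥ (W (tgt' e') (σ e' x) *ᵥ fun b => u (σ e' x, b))) - c) =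
          ((W (tgt' e') (σ e' x) *ᵥ fun b => u (σ e' x, b)) - fun a => (Q *ᵥ u) (tgt' e', a)) ⬝ᵥ
            ((W (tgt' e') (σ e' x) *ᵥ fun b => u (σ e' x, b)) - fun a => (Q *ᵥ u) (tgt' e', a)) := fun x => by
        rw [hc, ← mulVec_sub, self_of_orthogonal (hR' e')]
      simp_rw [hre, ← hσq e']
      rw [Equiv.sum_comp (σ e') (fun x => q (tgt' e') x *
        (((W (tgt' e') x *ᵥ fun b => u (x, b)) - fun a => (Q *ᵥ u) (tgt' e', a)) ⬝ᵥ
          ((W (tgt' e') x *ᵥ fun b => u (x, b)) - fun a => (Q *ᵥ u) (tgt' e', a))))]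
      exact hP (tgt' e')
  -- sum over the coarse bonds
  have hsum : ∑ e', ((R' e' *ᵥ fun a => (Q *ᵥ u) (tgt' e', a)) - fun a => (Q *ᵥ u) (src' e', a)) ⬝ᵥ
          ((R' e' *ᵥ fun a => (Q *ᵥ u) (tgt' e', a)) - fun a => (Q *ᵥ u) (src' e', a)) ≤
        (1 + t) * (ℓ * ∑ e', ∑ x, q (src' e') x * ∑ i ∈ range ℓ, F (γ e' x i)) +
          (1 + t⁻¹) * ((1 + r) * (κ ^ 2 * ∑ e', Φ u (tgt' e')) + (1 + r⁻¹) * ∑ e', Ψ e') := by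
    refine (Finset.sum_le_sum fun e' _ => hper e').trans (le_of_eq ?_)
    simp only [Finset.sum_add_distrib, ← Finset.mul_sum]
  have hmu := sum_chain_le_of_multiplicity q src' γ ℓ hmult F hF0
  have hSF : 0 ≤ ∑ e, F e := Finset.sum_nonneg fun e _ => hF0 e
  have hHfu := hHf u
  refine (mul_le_mul_of_nonneg_left hsum hwc).trans ?_
  have h1 : wc * ((1 + t) * (ℓ * ∑ e', ∑ x, q (src' e') x * ∑ i ∈ range ℓ, F (γ e' x i))) ≤ (1 + t) * (u ⬝ᵥ (Hf *ᵥ u)) := by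
    have a1 : wc * ((1 + t) * (ℓ * ∑ e', ∑ x, q (src' e') x * ∑ i ∈ range ℓ, F (γ e' x i))) ≤ wc * ((1 + t) * (ℓ * (m * ∑ e, F e))) :=
      mul_le_mul_of_nonneg_left (mul_le_mul_of_nonneg_left (mul_le_mul_of_nonneg_left hmu (Nat.cast_nonneg _)) (by linarith)) hwc
    have a2 : wc * ((1 + t) * (ℓ * (m * ∑ e, F e))) = (1 + t) * ((wc * ℓ * m) * ∑ e, F e) := by ring
    have a3 : (wc * ℓ * m) * ∑ e, F e ≤ u ⬝ᵥ (Hf *ᵥ u) := (mul_le_mul_of_nonneg_right hw hSF).trans hHfu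
    rw [a2] at a1
    exact a1.trans (mul_le_mul_of_nonneg_left a3 (by linarith))
  have h2 : wc * ((1 + t⁻¹) * ((1 + r) * (κ ^ 2 * ∑ e', Φ u (tgt' e')))) ≤ (1 + t⁻¹) * (1 + r) * ϖ * κ ^ 2 * (u ⬝ᵥ (Hf *ᵥ u)) := by
    have : wc * ((1 + t⁻¹) * ((1 + r) * (κ ^ 2 * ∑ e', Φ u (tgt' e')))) = (1 + t⁻¹) * (1 + r) * κ ^ 2 * (wc * ∑ e', Φ u (tgt' e')) := by ring
    rw [this]
    have := mul_le_mul_of_nonneg_left hΦ (show (0 : ℝ) ≤ (1 + t⁻¹) * (1 + r) * κ ^ 2 by positivity)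
    linarith [this]
  have h3 : wc * ((1 + t⁻¹) * ((1 + r⁻¹) * ∑ e', Ψ e')) ≤ (1 + t⁻¹) * (1 + r⁻¹) * Z := by
    have : wc * ((1 + t⁻¹) * ((1 + r⁻¹) * ∑ e', Ψ e')) = (1 + t⁻¹) * (1 + r⁻¹) * (wc * ∑ e', Ψ e') := by ring
    rw [this]
    exact mul_le_mul_of_nonneg_left hΨ (by positivity)
  have split : wc * ((1 + t) * (ℓ * ∑ e', ∑ x, q (src' e') x * ∑ i ∈ range ℓ, F (γ e' x i)) +
        (1 + t⁻¹) * ((1 + r) * (κ ^ 2 * ∑ e', Φ u (tgt' e')) + (1 + r⁻¹) * ∑ e', Ψ e')) =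
      wc * ((1 + t) * (ℓ * ∑ e', ∑ x, q (src' e') x * ∑ i ∈ range ℓ, F (γ e' x i))) +
        (wc * ((1 + t⁻¹) * ((1 + r) * (κ ^ 2 * ∑ e', Φ u (tgt' e')))) + wc * ((1 + t⁻¹) * ((1 + r⁻¹) * ∑ e', Ψ e'))) := by
    ring
  rw [split]
  linarith [h1, h2, h3]

/-- **`covJensen_massDatum` — THE ABSTRACT MASS-DATUM END** [our proof]: PART 47's `covJensen_meanZero` with the block-mean-defect letter `κ₂`
REPLACED by a per-bond MASS DATUM `|S_{e′}·R′_{e′}(Qu)(tgt′e′)|² ≤ Ψ(e′)` with budget `w_c·Σ_{e′}Ψ(e′) ≤ Z` (all other letters as in PART 47, the coarse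
form bound `hHc` included).  THEN for all `t, r > 0`: `⟨Qu, H_cQu⟩ ≤ (1 + t + (1+t⁻¹)(1+r)ϖκ²)·⟨u, H_f u⟩ + (1+t⁻¹)(1+r⁻¹)·Z` (any convention; PART 47 is
the case `Z = κ₂²·w_c·d′·⟨Qu,Qu⟩`). -/
theorem covJensen_massDatum
    (hq : ∀ y x, 0 ≤ q y x) (hq1 : ∀ y, ∑ x, q y x ≤ 1) (hW : ∀ y x, (W y x)ᵀ * W y x = 1) (hR : ∀ e, (R e)ᵀ * R e = 1)
    (hR' : ∀ e', (R' e')ᵀ * R' e' = 1)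
    (hQ : ∀ (u : ν × o → ℝ) (y : μ), (fun a => (Q *ᵥ u) (y, a)) = ∑ x, q y x • (W y x *ᵥ fun b => u (x, b)))
    (hwc : 0 ≤ wc)
    (hHc : ∀ v : μ × o → ℝ, v ⬝ᵥ (Hc *ᵥ v) ≤
      wc * ∑ e', ((R' e' *ᵥ fun a => v (tgt' e', a)) - fun a => v (src' e', a)) ⬝ᵥ
        ((R' e' *ᵥ fun a => v (tgt' e', a)) - fun a => v (src' e', a)))
    (hHf : ∀ u : ν × o → ℝ, wf * ∑ e, ((R e *ᵥ fun b => u (tgt e, b)) - fun b => u (src e, b)) ⬝ᵥ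
        ((R e *ᵥ fun b => u (tgt e, b)) - fun b => u (src e, b)) ≤ u ⬝ᵥ (Hf *ᵥ u))
    (hσq : ∀ e' x, q (tgt' e') (σ e' x) = q (src' e') x)
    (hx0 : ∀ e' x, xs e' x 0 = x) (hxℓ : ∀ e' x, xs e' x ℓ = σ e' x)
    (hsrc : ∀ e' x i, i < ℓ → src (γ e' x i) = xs e' x i) (htgt : ∀ e' x i, i < ℓ → tgt (γ e' x i) = xs e' x (i + 1))
    (hT0 : ∀ e' x, T e' x 0 = 1) (hT : ∀ e' x i, i < ℓ → T e' x (i + 1) = T e' x i * R (γ e' x i))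
    (hmult : ∀ e, ∑ e', ∑ x, ∑ i ∈ range ℓ, (if γ e' x i = e then q (src' e') x else 0) ≤ m)
    (hw : wc * ℓ * m ≤ wf)
    (hNdef : ∀ e' x, N e' x = 1 - W (src' e') x * T e' x ℓ * (W (tgt' e') (σ e' x))ᵀ * (R' e')ᵀ)
    (hN : ∀ e' x (w : o → ℝ), (N e' x *ᵥ w) ⬝ᵥ (N e' x *ᵥ w) ≤ κ ^ 2 * (w ⬝ᵥ w))
    (u : ν × o → ℝ)
    (hP : ∀ y, ∑ x, q y x * (((W y x *ᵥ fun b => u (x, b)) - fun a => (Q *ᵥ u) (y, a)) ⬝ᵥ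
        ((W y x *ᵥ fun b => u (x, b)) - fun a => (Q *ᵥ u) (y, a))) ≤ Φ u y)
    (hΦ : wc * ∑ e', Φ u (tgt' e') ≤ ϖ * (u ⬝ᵥ (Hf *ᵥ u)))
    (hS : ∀ e', ((∑ x, q (src' e') x • N e' x) *ᵥ (R' e' *ᵥ fun a => (Q *ᵥ u) (tgt' e', a))) ⬝ᵥ
        ((∑ x, q (src' e') x • N e' x) *ᵥ (R' e' *ᵥ fun a => (Q *ᵥ u) (tgt' e', a))) ≤ Ψ e')
    (hΨ : wc * ∑ e', Ψ e' ≤ Z)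
    {t r : ℝ} (ht : 0 < t) (hr : 0 < r) :
    (Q *ᵥ u) ⬝ᵥ (Hc *ᵥ (Q *ᵥ u)) ≤
      (1 + t + (1 + t⁻¹) * (1 + r) * ϖ * κ ^ 2) * (u ⬝ᵥ (Hf *ᵥ u)) + (1 + t⁻¹) * (1 + r⁻¹) * Z :=
  (hHc _).trans (sum_coarseDiff_sq_le_massDatum hq hq1 hW hR hR' hQ hwc hHf hσq hx0 hxℓ hsrc htgt hT0 hT hmult hw hNdef hN u hP hΦ hS hΨ ht hr)

end MassDatum

end Summit.QuantumFields.BalabanUV.Beta.GAN24.DerivativeRateTransferJensenMassFree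

end
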